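import Summits.BirchSwinnertonDyer.Rank1Residual.Additive.GordCharLeadingTerm
import Summits.BirchSwinnertonDyer.Rank1Residual.Additive.ChiBranchConstantTerm
import Summits.BirchSwinnertonDyer.Rank1Residual.X9.IwasawaLowerBound
import HarnessLib

/-!
# The (G)-ordinary cell, defect 2, `p ≡ 1 (mod 4)`, analytic rank `0`: the LOWER half from a
# RATIONAL `χ_p`-branch main conjecture for the good-ordinary twist plus ONE finite `μ`-certificate
# (cell `b2b-bsdres`, team n1011, seat n1011-p06, OWNERS row T-N10R)

HONEST FRAMING (cell `b2b-bsdres`, run/shared/lean/b2b/bsd-rank1-residual/, verbatim in every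
file): the goal of the cell is to DELETE the COMBINATION-SHAPED residual classes of the
Birch–Swinnerton-Dyer formula for ALL analytic-rank `≤ 1` elliptic curves over `ℚ` — "full BSD
formula for every rank `≤ 1` curve in class `C`" assembled STRICTLY from published theorems — so
that the rank-`≤ 1` remainder becomes exactly the CONSTRUCTION-SHAPED classes, which are TYPED
(missing-input `Prop`s), NOT attempted. This is not "finishing BSD". Team n1011 (X4 ∧ `p = 3` / the
additive block, §I items N10 / N11): research routes; prove what is provable now; no claim beyond
the stated classes; X4♯(G-ord) stays CONSTRUCTION-SHAPED; labels / census / located gap UNCHANGED;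
nothing is booked. One definition (a typed input, nothing asserted) and theorems; no new named fact.

## What and why

On the (G)-ordinary cell the rank-`0` residue of record is the LOWER half
`Typed.MissingLowerBoundAt W p` (§I N10, "X_D1"). Sub-cell additive-p2 (gen 13, gen 18) typed it at
the Iwasawa level as the INTEGRAL lower (Eisenstein) divisibility of Delbourgo's Main Conjecture (G)
at `T = 0` — `CycLowerLeadingTermAt W p`: for every generator `f` of `char_Λ X(E/ℚ_∞)`,
`L(E,1)/Ω_E ∣ f(0)` in `ℤ_p` — and proved (`exists_padicVal_shaAn_of_cycLowerLeadingTerm`, Delbourgo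
2002 Thm. (A)+(B)) that it gives the lower half on the non-anomalous rows. Every PRINTED theorem of
Skinner–Urban type is natively RATIONAL ("`Ch = (𝓛)` in `Λ ⊗ ℚ_p`", SU 2014 Thm. 3.6.4; Wan 2015
Thm. 4; BCS 2025 Thm. 1.1.2 (a)), and on the good-ordinary classes X9/X10b the cell closed the lower
half from exactly such a rational equality plus ONE finite certificate `μ(𝓛_p(E)) = 0`
(`X9/IwasawaLowerBound.lean`, gen 9: a unit coefficient forces the exponent `k ≥ 0`). This file
transplants that mechanism to the additive defect-2 rows (`E ≅ E♭ ⊗ χ_p`, `E♭` good ordinary at `p`,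
`p ≡ 1 (mod 4)` so that `χ_p = ω^{(p−1)/2}` is even and the relevant `p`-adic `L`-function is the
tree's even branch `padicLFunctionBranch f♭ α (p/2)`):

* §0 TYPED: `ChiBranchRatCharEqAt W p` — the `ω^{(p−1)/2}`-branch cyclotomic main conjecture for the
  good-ordinary twist as a RATIONAL equality: `X(E/ℚ_∞)` torsion, `char_Λ X(E/ℚ_∞) = (g)` and
  `ι g = p^k · ϖ · L_p(f♭, α, ω^{(p−1)/2}, T)` for some `k ∈ ℤ` (literally the shape of the tree's
  named fact `burungale_castella_skinner_charIdeal_eq_padicLFunction`, BCS 2025 Thm. 1.1.2 (a), with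
  `padicLFunction` replaced by the branch and the Selmer datum taken for the ADDITIVE curve `W` over
  `ℚ_∞` — the `χ_p`-eigencomponent of `X(E♭/ℚ(μ_{p^∞}))`, Greenberg LNM 1716 §5). Nothing asserted.
* §1 KERNEL: `cycLowerLeadingTermAt_of_chiBranchRatCharEq_of_unitCoeff` — (§0) + the finite
  certificate "some coefficient of `ϖ · L_p(f♭, α, ω^{(p−1)/2}, T)` is a `p`-adic unit" ⟹
  `k ≥ 0` (`X9.exponent_nonneg_of_exists_norm_coeff_eq_one`) ⟹ additive-p2's
  `CycLowerLeadingTermAt W p` (every generator `f = v·g`, `v ∈ Λ^×`, has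
  `f(0) = v(0)·u·p^k·ϖ·∑(a/p)[a/p]⁺ = c · L(E,1)/Ω_E` with `c ∈ ℤ_p`, by MTT §I.14
  `constantCoeff_eq_of_iwasawaToPowerSeries_eq_branch` and Birch + Pal `entireLFunction_one_eq_of_twist`).
* §2 CONSEQUENCES on X4♯(G-ord) ∩ `I₀*`, `p ≥ 5`, `p ≡ 1 (mod 4)`, `r_an = 0`, `E` non-CM: the LOWER
  half `MissingLowerBoundAt W p` on the non-anomalous rows (additive-p2's core + Delbourgo 2002,
  `hDel`), and `BSD(E,p)` when moreover `ρ̄_{E,p}` is onto (upper half = Kato's half-eigen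
  divisibility `hK` via `ClassX4Gord.missingUpperBoundAt_rankZero_of_katoHalf`).

## The located gap (unchanged in substance; sharpened in form)

`ChiBranchRatCharEqAt` is OPEN: its Kato divisibility `(ι g) ∣ p^k ϖ L_p(…)` rationally is the
`ω^i`-form attributed to Kato by Emerton–Pollack–Weston, Invent. Math. 163 (2006) Thm. 5.1.2 ("there
is a `u ∈ Λ_O ⊗ ℚ_p` such that `L_p^{alg}(f,ω^i) · u = L_p^{an}(f,ω^i)`") and by Kato 2004 Thm. 17.4
over `ℚ(μ_{p^∞})`; its Eisenstein divisibility on a NON-TRIVIAL branch `ω^{(p−1)/2}` is in no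
printed source (Skinner–Urban 2014 Thm. 3.6.4: trivial character, `p ∤ N`, the `Γ`-line only; the
`ω^{(p−1)/2}`-line of `E♭` is the `Γ`-line of `E = E♭ ⊗ χ_p`, additive at `p`, outside every ordinary
Hida family — see HOME/cells/n1011/skel/T-N10R.md §5). What this file changes: the residue on these
rows is a RATIONAL equality (what an SU-type theorem would print) plus a per-pair COMPUTABLE
certificate on the good-ordinary curve `E♭` (modular symbols, Néron-normalised), instead of an
integral divisibility. Nothing is certified here; X4♯(G-ord) stays CONSTRUCTION-SHAPED; nothing booked.

References: Burungale–Castella–Skinner, IMRN 2025 (arXiv:2405.00270v2) Thm. 1.1.2 (a)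
[BurungaleCastellaSkinner2025]; Emerton–Pollack–Weston, Invent. Math. 163 (2006) Thm. 5.1.2
[EmertonPollackWeston2006]; Kato, Astérisque 295 (2004) Thm. 17.4 [Kato2004Asterisque]; Skinner–Urban,
Invent. Math. 195 (2014) Thm. 3.6.4 [SkinnerUrban2014]; Mazur–Tate–Teitelbaum, Invent. Math. 84 (1986)
§I.13–I.14 [MazurTateTeitelbaum1986Invent]; Pal, Proc. AMS (2012) Thm. 3.2 [Pal2012]; Delbourgo,
J. Number Theory 95 (2002) Thm. (A), (B) [Delbourgo2002]; Greenberg, LNM 1716 (1999) §5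
[GreenbergLNM1716]; Miller, LMS J. Comput. Math. 14 (2011) Def. 1.1 [Miller2011LMS].
-/

noncomputable section

open scoped Classical MatrixGroups ModularForm NumberField

open CongruenceSubgroup WeierstrassCurve NumberField Literature.NumberTheory.EllipticCurves
  Literature.NumberTheory.EllipticCurves.ModularForms
  Literature.NumberTheory.EllipticCurves.Rank1Residual
  Literature.NumberTheory.EllipticCurves.Rank1Residual.Typed
  IsDedekindDomain

namespace Summit.BirchSwinnertonDyer.Rank1Residual.Additive

/-! ### §0 The typed input: the `χ_p`-branch main conjecture of the twist, RATIONAL form -/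

/-- **The `ω^{(p−1)/2}`-branch cyclotomic main conjecture for the good-ordinary twist, as a RATIONAL
equality, TYPED** (`p ≡ 1 (mod 4)`, even branch). For the additive curve `E = W` (globally minimal):
whenever `W` is `ℚ`-isomorphic to the quadratic twist by `p` of a globally minimal `V = E♭` that is
good ordinary at `p`, `f` is the newform of `V`, `κ`/`γ` is the cyclotomic `ℤ_p`-extension of `ℚ` with
a topological generator matching the cyclotomic variable, `D` a Pontryagin-dual datum of
`Sel_{p^∞}(W/ℚ_∞)` and `ϖ · Ω_V = Ω⁺_f`, then `X(W/ℚ_∞)` is `Λ`-torsion and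
`char_Λ X(W/ℚ_∞) = (g)` with `ι g = p^k · ϖ · L_p(f, α, ω^{(p−1)/2}, T)` for some `k ∈ ℤ`
(`α = unitRoot V p`, `ι : Λ ↪ ℚ_p⟦T⟧`): the conclusion SHAPE of the tree's
`burungale_castella_skinner_charIdeal_eq_padicLFunction` (BCS 2025 Thm. 1.1.2 (a), a rational
equality "in `Λ ⊗ ℚ_p`") with the trivial branch replaced by the `χ_p`-branch of the TWIST and the
Selmer datum taken for the additive `W` over `ℚ_∞` (= the `χ_p`-eigencomponent of
`X(V/ℚ(μ_{p^∞}))`, Greenberg LNM 1716 §5). OPEN — a predicate on `(W, p)`; its universal closure is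
NOT asserted (Kato half: EPW 2006 Thm. 5.1.2 / Kato 2004 Thm. 17.4; Eisenstein half on a non-trivial
branch: no printed source). [cite: BurungaleCastellaSkinner2025, Thm. 1.1.2 (a) (shape only; nothing asserted)]
[cite: GreenbergLNM1716, §5 (PDF p. 143) (shape only; nothing asserted)] -/
def ChiBranchRatCharEqAt (W : WeierstrassCurve ℚ) (p : ℕ) [Fact p.Prime] : Prop :=
  ∀ (V : WeierstrassCurve ℚ) [V.IsElliptic] [V.IsGloballyMinimal]
    {κ : ZpExtension ℚ p} {γ : Field.absoluteGaloisGroup ℚ} {N : ℕ} [NeZero N]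
    {f : CuspForm (Gamma0 N) 2},
    p % 4 = 1 →
    (∃ C : VariableChange ℚ, C • V.quadraticTwist (p : ℚ) = W) →
    GoodOrd V p →
    κ.IsCyclotomic → κ.IsTopGenerator γ → IsCyclotomicVariable p γ → IsNewformOf V f →
    ∀ (D : W.SelmerDualData κ γ) (ϖ : ℚ), (ϖ : ℝ) * V.realPeriodRat = plusPeriod f →
      D.IsTorsion ∧
      ∃ (g : IwasawaAlgebra p) (k : ℤ), D.charIdeal = Ideal.span {g} ∧
        iwasawaToPowerSeries p g =
          PowerSeries.C ((p : ℚ_[p]) ^ k * (ϖ : ℚ_[p])) *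
            padicLFunctionBranch f (unitRoot V p : ℚ_[p]) (p / 2)

/-- Unfolding lemma for `ChiBranchRatCharEqAt` (to apply the predicate as a function). -/
theorem chiBranchRatCharEqAt_iff (W : WeierstrassCurve ℚ) (p : ℕ) [Fact p.Prime] :
    ChiBranchRatCharEqAt W p ↔
      ∀ (V : WeierstrassCurve ℚ) [V.IsElliptic] [V.IsGloballyMinimal]
        {κ : ZpExtension ℚ p} {γ : Field.absoluteGaloisGroup ℚ} {N : ℕ} [NeZero N]
        {f : CuspForm (Gamma0 N) 2},
        p % 4 = 1 →
        (∃ C : VariableChange ℚ, C • V.quadraticTwist (p : ℚ) = W) →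
        GoodOrd V p →
        κ.IsCyclotomic → κ.IsTopGenerator γ → IsCyclotomicVariable p γ → IsNewformOf V f →
        ∀ (D : W.SelmerDualData κ γ) (ϖ : ℚ), (ϖ : ℝ) * V.realPeriodRat = plusPeriod f →
          D.IsTorsion ∧
          ∃ (g : IwasawaAlgebra p) (k : ℤ), D.charIdeal = Ideal.span {g} ∧
            iwasawaToPowerSeries p g =
              PowerSeries.C ((p : ℚ_[p]) ^ k * (ϖ : ℚ_[p])) *
                padicLFunctionBranch f (unitRoot V p : ℚ_[p]) (p / 2) :=
  Iff.rfl

variable (W : WeierstrassCurve ℚ) [W.IsElliptic] [W.IsGloballyMinimal] (p : ℕ) [hp : Fact p.Prime]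

/-! ### §1 The kernel step: rational branch equality + a unit coefficient ⟹ the integral lower divisibility at `T = 0` -/

omit [W.IsElliptic] [W.IsGloballyMinimal] in
variable {W p} in
/-- Two generators of the (principal) characteristic ideal differ by a unit of `Λ = ℤ_p⟦T⟧` (a
domain): if `char = (g) = (f)` then `f = g · v` for some `v ∈ Λ^×`. Bookkeeping. [folklore] -/
theorem exists_units_mul_eq_of_span_eq {κ : ZpExtension ℚ p} {γ : Field.absoluteGaloisGroup ℚ}
    (D : W.SelmerDualData κ γ) {g f : IwasawaAlgebra p} (hg : D.charIdeal = Ideal.span {g})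
    (hf : D.charIdeal = Ideal.span {f}) : ∃ v : (IwasawaAlgebra p)ˣ, f = g * v := by
  have h : Ideal.span ({g} : Set (IwasawaAlgebra p)) = Ideal.span {f} := hg.symm.trans hf
  obtain ⟨v, hv⟩ := Ideal.span_singleton_eq_span_singleton.mp h
  exact ⟨v, hv.symm⟩

/-- **Rational `χ_p`-branch main conjecture + ONE unit coefficient ⟹ the LOWER divisibility at
`T = 0`.** Let `E = W` be globally minimal, additive at a prime `p ≡ 1 (mod 4)`, `ℚ`-isomorphic to the
twist by `p` of a globally minimal `V = E♭` good ordinary at `p`, with newform `f` and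
`ϖ · Ω_V = Ω⁺_f`. Assume the typed rational equality `ChiBranchRatCharEqAt W p` (§0) and the finite
certificate `hcert`: SOME coefficient of `ϖ · L_p(f, α, ω^{(p−1)/2}, T)` is a `p`-adic unit
(`μ = 0` for the Néron-normalised branch; computable from the modular symbols of `E♭`). Then
additive-p2's `CycLowerLeadingTermAt W p` holds: for EVERY generator `f'` of `char_Λ X(E/ℚ_∞)`,
`L(E,1)/Ω_E` divides `f'(0)` in `ℤ_p`. Proof: `ι g = p^k ϖ L_p(…)` with a unit coefficient of
`ϖ L_p(…)` forces `k ≥ 0` (`X9.exponent_nonneg_of_exists_norm_coeff_eq_one`: `g` has integral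
coefficients); `g(0) = u · p^k ϖ · ∑_{a mod p}(a/p)[a/p]⁺_f`, `u = α⁻¹ ∈ ℤ_p^×` (MTT §I.14,
`constantCoeff_eq_of_iwasawaToPowerSeries_eq_branch`); `L(E,1) = ε ϖ (∑…) Ω_E`, `ε = ±1` (Birch + Pal
2012 Thm. 3.2 `hPal`, modularity `hmod`: `entireLFunction_one_eq_of_twist`); and `f' = g·v`, `v ∈ Λ^×`,
so `f'(0) = (v(0) u ε p^k) · L(E,1)/Ω_E` with `v(0) u ε p^k ∈ ℤ_p`.
[cite: MazurTateTeitelbaum1986Invent, §I.14] [cite: Pal2012, Thm. 3.2] -/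
theorem cycLowerLeadingTermAt_of_chiBranchRatCharEq_of_unitCoeff
    (hPal : Pal2012.thm32_sqrt_mul_realPeriodRat_twist_eq_of_prime_one_mod_four)
    (hmod : hasEntireLFunction_rat) (hp4 : p % 4 = 1) (hadd : Addv W p)
    (V : WeierstrassCurve ℚ) [V.IsElliptic] [V.IsGloballyMinimal]
    (hVW : ∃ C : VariableChange ℚ, C • V.quadraticTwist (p : ℚ) = W) (hV : GoodOrd V p)
    {N : ℕ} [NeZero N] {f : CuspForm (Gamma0 N) 2} (hf : IsNewformOf V f)
    (ϖ : ℚ) (hϖ : (ϖ : ℝ) * V.realPeriodRat = plusPeriod f)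
    (hMC : ChiBranchRatCharEqAt W p)
    (hcert : ∃ n : ℕ, ‖PowerSeries.coeff n
        (PowerSeries.C (ϖ : ℚ_[p]) * padicLFunctionBranch f (unitRoot V p : ℚ_[p]) (p / 2))‖ = 1) :
    CycLowerLeadingTermAt W p := by
  have hpP : p.Prime := hp.out
  have hp2 : p ≠ 2 := by omega
  intro κ γ hκ hγ hγ' D f' hf'
  obtain ⟨-, g, k, hchar, hιg⟩ := hMC V hp4 hVW hV hκ hγ hγ' hf D ϖ hϖ
  -- `k ≥ 0` from the certificate
  have hιg' : iwasawaToPowerSeries p g = PowerSeries.C ((p : ℚ_[p]) ^ k) *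
      (PowerSeries.C (ϖ : ℚ_[p]) * padicLFunctionBranch f (unitRoot V p : ℚ_[p]) (p / 2)) := by
    rw [hιg, map_mul, mul_assoc]
  have hk : 0 ≤ k := X9.exponent_nonneg_of_exists_norm_coeff_eq_one g _ k hιg' hcert
  obtain ⟨m, rfl⟩ : ∃ m : ℕ, k = m := ⟨k.toNat, (Int.toNat_of_nonneg hk).symm⟩
  -- the constant term of `g`: `u · (p^m ϖ) · ∑ (a/p)[a/p]⁺_f`
  have hord : IsOrdinaryAt V p := (isOrdinaryAt_iff V p).mpr ⟨hV.1, hV.2⟩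
  have hιg'' : iwasawaToPowerSeries p g =
      PowerSeries.C ((((p : ℚ) ^ m * ϖ : ℚ)) : ℚ_[p]) *
        padicLFunctionBranch f (unitRoot V p : ℚ_[p]) (p / 2) := by
    rw [hιg, zpow_natCast]
    push_cast
    rfl
  obtain ⟨u, hg0⟩ := constantCoeff_eq_of_iwasawaToPowerSeries_eq_branch p hp2 V hord hf hιg''
  -- the `L`-value: `L(E,1) = ε ϖ (∑…) Ω_E`
  obtain ⟨ε, hε, hLq⟩ := entireLFunction_one_eq_of_twist p hPal hmod hp4 V W hVW (Or.inl hV.1) hadd hf ϖ hϖ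
  have hε2 : ((ε : ℚ) : ℚ_[p]) ^ 2 = 1 := by rcases hε with rfl | rfl <;> norm_num
  have hε0 : ε ≠ 0 := by rcases hε with rfl | rfl <;> norm_num
  have hεv : padicValRat p ε = 0 := by
    rcases hε with rfl | rfl
    · exact padicValRat.one
    · rw [padicValRat.neg]; exact padicValRat.one
  obtain ⟨w, hw⟩ := exists_units_coe_eq_ratCast p hε0 hεv
  -- the generator `f'` is `g · v`, `v` a unit
  obtain ⟨v, rfl⟩ := exists_units_mul_eq_of_span_eq D hchar hf'
  refine ⟨ε * (ϖ * legendrePlusSymbolSum f p), hLq,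
    PowerSeries.constantCoeff (v : IwasawaAlgebra p) * (u : ℤ_[p]) * (w : ℤ_[p]) *
      (p : ℤ_[p]) ^ m, ?_⟩
  simp only [map_mul, PadicInt.coe_mul]
  rw [hg0]
  push_cast
  rw [hw]
  linear_combination
    (-(((u : ℤ_[p]) : ℚ_[p]) * (p : ℚ_[p]) ^ m * (ϖ : ℚ_[p]) * (legendrePlusSymbolSum f p : ℚ_[p]) *
      ((PowerSeries.constantCoeff (v : IwasawaAlgebra p) : ℤ_[p]) : ℚ_[p]))) * hε2

/-! ### §2 Consequences on X4♯(G-ord) ∩ `I₀*`, `p ≡ 1 (mod 4)`: the class forms -/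

variable {W p}

/-- **X4♯(G-ord) ∩ `I₀*`, `p ≡ 1 (mod 4)`: the integral lower divisibility at `T = 0` from the
rational branch main conjecture and the `μ`-certificate of the twist.** For `(E,p) ∈ X4♯(G-ord)`
with semistability defect `e = 2` (so `E = E♭ ⊗ χ_p` with `E♭` good ordinary at `p`,
`ClassX4Gord.exists_goodOrd_pStar_twist_model`) at a prime `p ≡ 1 (mod 4)`: `ChiBranchRatCharEqAt W p`
together with the certificate `hcert` — for every good-ordinary twist model `V`, its newform `f` and
`ϖ·Ω_V = Ω⁺_f`, some coefficient of `ϖ · L_p(f, α, ω^{(p−1)/2}, T)` is a `p`-adic unit (one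
modular-symbol computation on `E♭`; the quantifiers only range over `ℚ`-isomorphic minimal models and
THE newform) — gives `CycLowerLeadingTermAt W p`. Binders: Pal 2012 (`hPal`), modularity (`hmod`), a
modular parametrisation datum for the newform/period ratio (`hmodD`).
[cite: MazurTateTeitelbaum1986Invent, §I.14] [cite: Pal2012, Thm. 3.2] -/
theorem ClassX4Gord.cycLowerLeadingTermAt_of_ratCharEq_of_unitCoeff
    (hPal : Pal2012.thm32_sqrt_mul_realPeriodRat_twist_eq_of_prime_one_mod_four)
    (hmod : hasEntireLFunction_rat) (hmodD : nonempty_modularParametrizationData)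
    (hX : ClassX4Gord W p) (he : semistabilityIndex W p = 2) (hp4 : p % 4 = 1)
    (hMC : ChiBranchRatCharEqAt W p)
    (hcert : ∀ (V : WeierstrassCurve ℚ) [V.IsElliptic] [V.IsGloballyMinimal] (C : VariableChange ℚ),
      GoodOrd V p → C • V.quadraticTwist (p : ℚ) = W →
      ∀ {N : ℕ} [NeZero N] (f : CuspForm (Gamma0 N) 2), IsNewformOf V f →
      ∀ ϖ : ℚ, (ϖ : ℝ) * V.realPeriodRat = plusPeriod f →
      ∃ n : ℕ, ‖PowerSeries.coeff n
        (PowerSeries.C (ϖ : ℚ_[p]) * padicLFunctionBranch f (unitRoot V p : ℚ_[p]) (p / 2))‖ = 1) :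
    CycLowerLeadingTermAt W p := by
  obtain ⟨V, iV, iVm, C, hV, hC⟩ := hX.exists_goodOrd_pStar_twist_model W p he
  haveI : NeZero (V.conductorNorm ℤ) := ⟨(V.conductorNorm_pos_holds).ne'⟩
  obtain ⟨Dm⟩ := hmodD V
  obtain ⟨ϖ, -, hϖ, -⟩ := Dm.exists_rat_mul_realPeriodRat_eq_plusPeriod
  have hC' : C • V.quadraticTwist (p : ℚ) = W := by
    rw [pStar_eq_of_mod_four p (Or.inl hp4), if_pos hp4] at hC
    exact hC
  exact cycLowerLeadingTermAt_of_chiBranchRatCharEq_of_unitCoeff W p hPal hmod hp4 hX.addv.2 V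
    ⟨C, hC'⟩ hV Dm.isNewformOf ϖ hϖ hMC (hcert V C hV hC' Dm.f Dm.isNewformOf ϖ hϖ)

/-- **X4♯(G-ord) ∩ `I₀*` ∩ non-anomalous, `p ≥ 5`, `p ≡ 1 (mod 4)`, `E` non-CM, `r_an = 0`: the LOWER
half `ord_p #Ш_an(E) ≤ ord_p #Ш(E)` from the rational branch main conjecture and the `μ`-certificate**
— through additive-p2's `exists_padicVal_shaAn_of_cycLowerLeadingTerm` (Delbourgo 2002 Thm. (A)+(B),
`hDel`: `ord_p #Ш_an + ord_p c = ord_p #Ш + ord_p ℓ`, `ℓ = 1` on the non-anomalous rows, `c ∈ ℤ_p`).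
The cell's rank-`0` residue "X_D1" on these rows is thus a RATIONAL branch main conjecture for the
good-ordinary curve `E♭` plus one finite certificate. X4♯(G-ord) stays CONSTRUCTION-SHAPED.
[cite: Delbourgo2002, Theorem (A), (B) (p. 40)] [cite: BurungaleCastellaSkinner2025, Thm. 1.1.2 (a) (shape only)] -/
theorem ClassX4Gord.missingLowerBoundAt_rankZero_of_ratCharEq_of_unitCoeff
    (hDel : Delbourgo2002.mainTheorem)
    (hPal : Pal2012.thm32_sqrt_mul_realPeriodRat_twist_eq_of_prime_one_mod_four)
    (hGZK : rank_eq_analyticRank_of_analyticRank_le_one) (hmod : hasEntireLFunction_rat)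
    (hmodD : nonempty_modularParametrizationData)
    (hX : ClassX4Gord W p) (he : semistabilityIndex W p = 2) (hp5 : 5 ≤ p) (hp4 : p % 4 = 1)
    (hcm : ¬ W.HasCM) (hr : W.analyticRank = 0) (hna : Delbourgo2002.ReductionNonAnomalous W p)
    (hMC : ChiBranchRatCharEqAt W p)
    (hcert : ∀ (V : WeierstrassCurve ℚ) [V.IsElliptic] [V.IsGloballyMinimal] (C : VariableChange ℚ),
      GoodOrd V p → C • V.quadraticTwist (p : ℚ) = W →
      ∀ {N : ℕ} [NeZero N] (f : CuspForm (Gamma0 N) 2), IsNewformOf V f →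
      ∀ ϖ : ℚ, (ϖ : ℝ) * V.realPeriodRat = plusPeriod f →
      ∃ n : ℕ, ‖PowerSeries.coeff n
        (PowerSeries.C (ϖ : ℚ_[p]) * padicLFunctionBranch f (unitRoot V p : ℚ_[p]) (p / 2))‖ = 1) :
    MissingLowerBoundAt W p := by
  have hLow := ClassX4Gord.cycLowerLeadingTermAt_of_ratCharEq_of_unitCoeff hPal hmod hmodD hX he
    hp4 hMC hcert
  obtain ⟨q, hq, -, c, ℓ, -, -, hℓ1, hval⟩ :=
    exists_padicVal_shaAn_of_cycLowerLeadingTerm W p hDel hGZK hmod hp5 hcm hX.addv.2 hX.typeGOrd hr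
      hLow
  refine ⟨q, hq, ?_⟩
  have hc : 0 ≤ ((c : ℤ_[p]) : ℚ_[p]).valuation := PadicInt.valuation_coe_nonneg
  rw [hℓ1 hna, padicValNat_one_right, Nat.cast_zero, add_zero] at hval
  linarith

/-- **X4♯(G-ord) ∩ `I₀*` ∩ non-anomalous ∩ {`ρ̄_{E,p}` onto}, `p ≥ 5`, `p ≡ 1 (mod 4)`, `E` non-CM,
`r_an = 0`: `BSD(E,p)` from the rational branch main conjecture and the `μ`-certificate** — lower half
from `ClassX4Gord.missingLowerBoundAt_rankZero_of_ratCharEq_of_unitCoeff`, upper half IN PRINT: Kato's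
half-eigen divisibility over `ℚ(μ_{p^∞})` (`hK`, Kato 2004 Thm. 17.4 (3)) through gen 12's
`ClassX4Gord.missingUpperBoundAt_rankZero_of_katoHalf` (+ Delbourgo 1998 Prop. 4 `hDel98`). NO
`#Ш_an`-unit, Tamagawa or Manin hypothesis. The one input not in print is the Eisenstein half of
`ChiBranchRatCharEqAt W p`; nothing is booked. [cite: Kato2004Asterisque, Thm. 17.4 (3) (p. 273)]
[cite: Delbourgo2002, Theorem (A), (B) (p. 40)] [cite: Miller2011LMS, Def. 1.1] -/
theorem ClassX4Gord.bsdp_rankZero_of_ratCharEq_of_unitCoeff_of_katoHalf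
    (hDel : Delbourgo2002.mainTheorem)
    (hK : Wuthrich2014.kato_halfEigenCharIdeal_dvd_cyclotomicPrime_of_surjective)
    (hDel98 : Delbourgo1998.prop4_rankZero_pow_dvd_constantCoeff)
    (hPal : Pal2012.thm32_sqrt_mul_realPeriodRat_twist_eq_of_prime_one_mod_four)
    (hGZK : rank_eq_analyticRank_of_analyticRank_le_one) (hmod : hasEntireLFunction_rat)
    (hmodD : nonempty_modularParametrizationData)
    (hX : ClassX4Gord W p) (he : semistabilityIndex W p = 2) (hp5 : 5 ≤ p) (hp4 : p % 4 = 1)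
    (hcm : ¬ W.HasCM) (hr : W.analyticRank = 0) (hna : Delbourgo2002.ReductionNonAnomalous W p)
    (hsurj : Surj W p) (hMC : ChiBranchRatCharEqAt W p)
    (hcert : ∀ (V : WeierstrassCurve ℚ) [V.IsElliptic] [V.IsGloballyMinimal] (C : VariableChange ℚ),
      GoodOrd V p → C • V.quadraticTwist (p : ℚ) = W →
      ∀ {N : ℕ} [NeZero N] (f : CuspForm (Gamma0 N) 2), IsNewformOf V f →
      ∀ ϖ : ℚ, (ϖ : ℝ) * V.realPeriodRat = plusPeriod f →
      ∃ n : ℕ, ‖PowerSeries.coeff n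
        (PowerSeries.C (ϖ : ℚ_[p]) * padicLFunctionBranch f (unitRoot V p : ℚ_[p]) (p / 2))‖ = 1) :
    BSDp W p :=
  bsdp_of_missingPPartAt W p hGZK (by rw [hr]; exact zero_le_one)
    (missingPPartAt_of_lower_of_upper W p
      (ClassX4Gord.missingLowerBoundAt_rankZero_of_ratCharEq_of_unitCoeff hDel hPal hGZK hmod hmodD hX
        he hp5 hp4 hcm hr hna hMC hcert)
      (ClassX4Gord.missingUpperBoundAt_rankZero_of_katoHalf hK hDel98 hGZK hmod hmodD hX he hr hsurj
        (fun h3 ↦ absurd h3 (by omega))))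

/-- **What remains on these rows, granted the certificate, is EXACTLY the rational branch main
conjecture's output**: on X4♯(G-ord) ∩ `I₀*` ∩ non-anomalous ∩ {`ρ̄` onto}, `p ≥ 5`, `p ≡ 1 (mod 4)`,
non-CM, `r_an = 0`, the typed residue `Typed.X4.MissingInputAt W p` follows from
`ChiBranchRatCharEqAt W p` + the certificate (and conversely `BSD(E,p)` gives it back:
`missingPPartAt_of_bsdp`). [cite: Miller2011LMS, Def. 1.1] -/
theorem ClassX4Gord.missingInputAt_rankZero_of_ratCharEq_of_unitCoeff_of_katoHalf
    (hDel : Delbourgo2002.mainTheorem)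
    (hK : Wuthrich2014.kato_halfEigenCharIdeal_dvd_cyclotomicPrime_of_surjective)
    (hDel98 : Delbourgo1998.prop4_rankZero_pow_dvd_constantCoeff)
    (hPal : Pal2012.thm32_sqrt_mul_realPeriodRat_twist_eq_of_prime_one_mod_four)
    (hGZK : rank_eq_analyticRank_of_analyticRank_le_one) (hmod : hasEntireLFunction_rat)
    (hmodD : nonempty_modularParametrizationData)
    (hX : ClassX4Gord W p) (he : semistabilityIndex W p = 2) (hp5 : 5 ≤ p) (hp4 : p % 4 = 1)
    (hcm : ¬ W.HasCM) (hr : W.analyticRank = 0) (hna : Delbourgo2002.ReductionNonAnomalous W p)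
    (hsurj : Surj W p) (hMC : ChiBranchRatCharEqAt W p)
    (hcert : ∀ (V : WeierstrassCurve ℚ) [V.IsElliptic] [V.IsGloballyMinimal] (C : VariableChange ℚ),
      GoodOrd V p → C • V.quadraticTwist (p : ℚ) = W →
      ∀ {N : ℕ} [NeZero N] (f : CuspForm (Gamma0 N) 2), IsNewformOf V f →
      ∀ ϖ : ℚ, (ϖ : ℝ) * V.realPeriodRat = plusPeriod f →
      ∃ n : ℕ, ‖PowerSeries.coeff n
        (PowerSeries.C (ϖ : ℚ_[p]) * padicLFunctionBranch f (unitRoot V p : ℚ_[p]) (p / 2))‖ = 1) :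
    X4.MissingInputAt W p := by
  haveI : Finite W.sha := (hGZK W (by rw [hr]; exact zero_le_one)).2
  exact missingPPartAt_of_bsdp W p
    (ClassX4Gord.bsdp_rankZero_of_ratCharEq_of_unitCoeff_of_katoHalf hDel hK hDel98 hPal hGZK hmod hmodD
      hX he hp5 hp4 hcm hr hna hsurj hMC hcert)

end Summit.BirchSwinnertonDyer.Rank1Residual.Additive

end
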